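import Mathlib
import HarnessLib
import Summits.ValiantsHypothesis.ValiantsHypothesis.Theorems.SchenstedIndexPowTraceCertificateTools
import Summits.ValiantsHypothesis.ValiantsHypothesis.Theorems.SchenstedIndexCountVectors

/-!
# Route SchenstedIndex — `span_n(t,m)` is the span of the block-coefficient vectors of power traces
# of SLOT pencils (towards the completeness of the sector certificates, cruxes 16081 / 16085)

For a slot pencil `Ã = ∑_s y_s N_s` (`N : S → M_n(ℂ)`, one matrix per SLOT `s ∈ S = Fin t × Fin m × Fin m`)
the vector of square-free block coefficients of its power trace,
`E(N)(π) := ∏_(B ∈ π) coeff_(y^B) tr(Ã^m)`, satisfies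

* `prod_coeff_indicator_trace_pencil_pow_eq_sum` — `E(N)(π) = ∑_(ρ : S → [n]) v_(X_ρ(N))(π)` with the
  slot matrices `X_ρ(N)(s,s') = (N_s)_(ρ s, ρ s')` (the trace side of `powTraceCertificate_proof`, now
  as a standalone identity for every slot pencil);
* `sum_blockCycleVec_slotMatrix_single` — for the RANK-ONE pencil `N_s = E_(r₁ s, r₂ s)` of a
  bi-colouring `r : S → [n]²` the right-hand side collapses to ONE count vector,
  `∑_ρ v_(X_ρ(N))= v_(X_(r'))`, `r' = (r₂, r₁)`;
* **`span_blockCoeffVec_slotPencil_eq_span_count`** — hence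
  `span_ℂ {E(N) : N} = span_ℂ {count vectors} (= span_n(t,m)` by `span_blockCycleVec_rank_le_eq_span_count`).

So the span `span_n(t,m)` of the cruxes is EXACTLY the span of the block-coefficient vectors of
width-`n` power traces of slot pencils.  What separates this from the completeness of the sector
certificates (crux 16081 / rung 16085 as typed) is label-consistency (`N_s` depending only on the label
of `s`: polarisation over the `t` copies) and the passage from an ideal element of `Δ(tr X_n^m)` to a
functional on partitions — recorded as successor work.  Route-independent file.

HONEST FRAMING: structural bookkeeping for an OPEN crux; nothing here bears on `VP ≠ VNP`.
-/

set_option linter.dupNamespace false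

noncomputable section

namespace Summit.ValiantsHypothesis.ValiantsHypothesis.Theorems.SchenstedIndex

open MvPolynomial Matrix
open Literature.Computability.AlgebraicComplexity

/-- **Block coefficients of a slot pencil's power trace are sums of block-cycle vectors**: for
`N : S → M_n(ℂ)`, `m ≥ 1` and every `m`-block partition `π` of `S`,
`∏_(B ∈ π) coeff_(y^B) tr(Ã_N^m) = ∑_(ρ : S → [n]) v_(X_ρ(N))(π)`, `X_ρ(N)(s,s') = (N_s)_(ρ s, ρ s')`. -/
theorem prod_coeff_indicator_trace_pencil_pow_eq_sum {t m n : ℕ} (hm : 0 < m)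
    (N : Fin t × Fin m × Fin m → Matrix (Fin n) (Fin n) ℂ)
    (π : {π : Finpartition (Finset.univ : Finset (Fin t × Fin m × Fin m)) //
      ∀ B ∈ π.parts, B.card = m}) :
    (∏ B ∈ π.1.parts, coeff (∑ s ∈ B, Finsupp.single s 1)
        ((Matrix.of fun a b : Fin n => ∑ s : Fin t × Fin m × Fin m,
          C (N s a b) * (X s : MvPolynomial (Fin t × Fin m × Fin m) ℂ)) ^ m).trace) =
      ∑ ρ : Fin t × Fin m × Fin m → Fin n, ∏ B ∈ π.1.parts, ∑ q : Fin m ≃ ↥B,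
        ∏ i : Fin m, (Matrix.of fun s s' => N s (ρ s) (ρ s')) (q i).1 (q (finRotate m i)).1 := by
  classical
  rw [Finset.prod_congr rfl (fun B hB => coeff_indicator_trace_pencil_pow hm N B (π.2 B hB))]
  have hF := sum_prod_parts_eq_prod_sum π.1
    (fun (B : Finset (Fin t × Fin m × Fin m)) (r : ↥B → Fin n) =>
      ∑ q : Fin m ≃ ↥B, ∏ i : Fin m, N (q i) (r (q i)) (r (q (finRotate m i))))
  refine Eq.trans ?_ (hF.symm.trans ?_)
  · refine Finset.prod_congr rfl fun B _ => ?_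
    change (∑ v : Fin m → Fin n, ∑ q : Fin m ≃ ↥B,
        ∏ i : Fin m, N (q i) (v i) (v (finRotate m i))) =
      ∑ r : ↥B → Fin n, ∑ q : Fin m ≃ ↥B,
        ∏ i : Fin m, N (q i) (r (q i)) (r (q (finRotate m i)))
    rw [Finset.sum_comm]
    conv_rhs => rw [Finset.sum_comm]
    refine Finset.sum_congr rfl fun q _ => ?_
    exact (sum_arrow_eq_sum_comp q (fun v => ∏ i : Fin m, N (q i) (v i) (v (finRotate m i)))).symm
  · rfl

/-- **Rank-one slot pencils realise the count vectors**: for a bi-colouring `r : S → [n]²` and the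
pencil of matrix units `N_s = E_(r₁ s, r₂ s)`, `∑_ρ v_(X_ρ(N)) = v_(X_(r₂, r₁))` — only the colouring
`ρ = r₁` contributes (every slot occurs as a row index in its block cycle). -/
theorem sum_blockCycleVec_slotMatrix_single {t m n : ℕ}
    (r : Fin t × Fin m × Fin m → Fin n × Fin n)
    (π : {π : Finpartition (Finset.univ : Finset (Fin t × Fin m × Fin m)) //
      ∀ B ∈ π.parts, B.card = m}) :
    (∑ ρ : Fin t × Fin m × Fin m → Fin n, ∏ B ∈ π.1.parts, ∑ q : Fin m ≃ ↥B,
        ∏ i : Fin m, (Matrix.of fun s s' : Fin t × Fin m × Fin m =>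
          (Matrix.of fun a b : Fin n => if a = (r s).1 ∧ b = (r s).2 then (1 : ℂ) else 0)
            (ρ s) (ρ s')) (q i).1 (q (finRotate m i)).1) =
      ∏ B ∈ π.1.parts, ∑ q : Fin m ≃ ↥B, ∏ i : Fin m,
        (Matrix.of fun s s' : Fin t × Fin m × Fin m =>
          if (r s).2 = (r s').1 then (1 : ℂ) else 0) (q i).1 (q (finRotate m i)).1 := by
  classical
  rw [Finset.sum_eq_single (fun s => (r s).1)]
  · -- the surviving colouring `ρ = r₁`
    refine Finset.prod_congr rfl fun B _ => Finset.sum_congr rfl fun q _ =>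
      Finset.prod_congr rfl fun i _ => ?_
    simp only [Matrix.of_apply, true_and]
    by_cases h : (r (q i).1).2 = (r (q (finRotate m i)).1).1
    · rw [if_pos h.symm, if_pos h]
    · rw [if_neg (fun h' => h h'.symm), if_neg h]
  · -- any other colouring misses the row condition at some slot
    intro ρ _ hρ
    obtain ⟨s, hs⟩ : ∃ s, ρ s ≠ (r s).1 := by
      by_contra h
      push Not at h
      exact hρ (funext h)
    have hB : π.1.part s ∈ π.1.parts := π.1.part_mem.2 (Finset.mem_univ s)
    apply Finset.prod_eq_zero hB
    refine Finset.sum_eq_zero fun q _ => ?_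
    -- the slot `s` is `q i` for some `i`
    obtain ⟨i, hi⟩ := q.surjective ⟨s, π.1.mem_part (Finset.mem_univ s)⟩
    apply Finset.prod_eq_zero (Finset.mem_univ i)
    rw [Matrix.of_apply, Matrix.of_apply, if_neg]
    rw [hi]
    exact fun h => hs h.1
  · intro h; exact absurd (Finset.mem_univ _) h

/-- **`span_n(t,m)` is the span of the block-coefficient vectors of power traces of slot pencils**
(`m ≥ 1`): `span_ℂ {π ↦ ∏_(B ∈ π) coeff_(y^B) tr(Ã_N^m) : N : S → M_n(ℂ)}` equals the span of the
count vectors (and hence, by `span_blockCycleVec_rank_le_eq_span_count`, the span of the block-cycle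
vectors of all rank-`≤ n` slot matrices). -/
theorem span_blockCoeffVec_slotPencil_eq_span_count {t m n : ℕ} (hm : 0 < m) :
    Submodule.span ℂ (Set.range fun N : Fin t × Fin m × Fin m → Matrix (Fin n) (Fin n) ℂ =>
      fun π : {π : Finpartition (Finset.univ : Finset (Fin t × Fin m × Fin m)) //
          ∀ B ∈ π.parts, B.card = m} =>
        ∏ B ∈ π.1.parts, coeff (∑ s ∈ B, Finsupp.single s 1)
          ((Matrix.of fun a b : Fin n => ∑ s : Fin t × Fin m × Fin m,
            C (N s a b) * (X s : MvPolynomial (Fin t × Fin m × Fin m) ℂ)) ^ m).trace) =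
    Submodule.span ℂ (Set.range fun r : Fin t × Fin m × Fin m → Fin n × Fin n =>
      fun π : {π : Finpartition (Finset.univ : Finset (Fin t × Fin m × Fin m)) //
          ∀ B ∈ π.parts, B.card = m} =>
        ∏ B ∈ π.1.parts, ∑ q : Fin m ≃ ↥B, ∏ i : Fin m,
          (Matrix.of fun s s' : Fin t × Fin m × Fin m =>
            if (r s).1 = (r s').2 then (1 : ℂ) else 0) (q i).1 (q (finRotate m i)).1) := by
  classical
  apply le_antisymm
  · -- `⊆`: each block-coefficient vector is `∑_ρ v_(X_ρ(N))`, a sum of vectors of rank-`≤ n` matrices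
    rw [Submodule.span_le]
    rintro _ ⟨N, rfl⟩
    rw [SetLike.mem_coe, ← span_blockCycleVec_rank_le_eq_span_count]
    have hfun : (fun π : {π : Finpartition (Finset.univ : Finset (Fin t × Fin m × Fin m)) //
          ∀ B ∈ π.parts, B.card = m} =>
        ∏ B ∈ π.1.parts, coeff (∑ s ∈ B, Finsupp.single s 1)
          ((Matrix.of fun a b : Fin n => ∑ s : Fin t × Fin m × Fin m,
            C (N s a b) * (X s : MvPolynomial (Fin t × Fin m × Fin m) ℂ)) ^ m).trace) =
        ∑ ρ : Fin t × Fin m × Fin m → Fin n,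
          fun π : {π : Finpartition (Finset.univ : Finset (Fin t × Fin m × Fin m)) //
              ∀ B ∈ π.parts, B.card = m} =>
            ∏ B ∈ π.1.parts, ∑ q : Fin m ≃ ↥B, ∏ i : Fin m,
              (Matrix.of fun s s' => N s (ρ s) (ρ s')) (q i).1 (q (finRotate m i)).1 := by
      funext π
      rw [Finset.sum_apply]
      exact prod_coeff_indicator_trace_pencil_pow_eq_sum hm N π
    beta_reduce
    rw [hfun]
    exact Submodule.sum_mem _ fun ρ _ => Submodule.subset_span
      ⟨⟨Matrix.of fun s s' => N s (ρ s) (ρ s'), rank_slotMatrix_le N ρ⟩, rfl⟩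
  · -- `⊇`: the count vector of `r` is the block-coefficient vector of the rank-one pencil of `(r₂, r₁)`
    rw [Submodule.span_le]
    rintro _ ⟨r, rfl⟩
    refine Submodule.subset_span
      ⟨fun s => Matrix.of fun a b : Fin n => if a = (r s).2 ∧ b = (r s).1 then (1 : ℂ) else 0, ?_⟩
    funext π
    beta_reduce
    exact (prod_coeff_indicator_trace_pencil_pow_eq_sum hm _ π).trans
      (sum_blockCycleVec_slotMatrix_single (fun s => ((r s).2, (r s).1)) π)

end Summit.ValiantsHypothesis.ValiantsHypothesis.Theorems.SchenstedIndex

end
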